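import Literature.NumberTheory.EllipticCurves.ZpCorankStable
import HarnessLib

/-!
# Stub `stub_zpCorankOfStable` of the line `toric-node-vacuity-cassels` (alias)

Crux `stmt-Parity-11584` (`Summit.Parity.BatemanHorn.Theses.IsogenyRedei.PencilSelmerDictionary`),
line `toric-node-vacuity-cassels`, registered stub `stub_zpCorankOfStable` (F2, pure group theory:
"the `ℤ_p`-corank of a stable `p`-primary group"). The mathematics lives in
`Literature.NumberTheory.EllipticCurves.pow_zpCorank_eq_natCard_torsionBy_inf_range_of_stable`;
this file records the registered signature verbatim as an alias.
-/

noncomputable section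

open scoped AddSubgroup

namespace Summit.Parity.BatemanHorn.Theorems.PencilSelmerDictionary

open Literature.NumberTheory.EllipticCurves

universe u

/-- **Stub `stub_zpCorankOfStable` (corank of a stable `p`-primary group).** For a `p`-primary
abelian group `A` with finite `A[p]` and a stability index `k` of the chain `A[p] ∩ p^{k'} A`,
`p ^ zpCorank A p = #(A[p] ∩ p^k A)`; alias of
`Literature.NumberTheory.EllipticCurves.pow_zpCorank_eq_natCard_torsionBy_inf_range_of_stable`.
[folklore] -/
theorem stub_zpCorankOfStable
    {A : Type u} [AddCommGroup A] (p : ℕ) [Fact p.Prime]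
    (hA : ∀ a : A, ∃ n : ℕ, p ^ n • a = 0) [Finite A[(p : ℤ)]] {k : ℕ}
    (hst : ∀ k', k ≤ k' → A[(p : ℤ)] ⊓ (nsmulAddMonoidHom (α := A) (p ^ k')).range =
      A[(p : ℤ)] ⊓ (nsmulAddMonoidHom (α := A) (p ^ k)).range) :
    p ^ zpCorank A p = Nat.card ↥(A[(p : ℤ)] ⊓ (nsmulAddMonoidHom (α := A) (p ^ k)).range) :=
  pow_zpCorank_eq_natCard_torsionBy_inf_range_of_stable p hA hst

end Summit.Parity.BatemanHorn.Theorems.PencilSelmerDictionary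

end
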